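import Summits.CriticalPhenomena.CardyFormulaZ2.Theses.CardyIKTransport
import Summits.CriticalPhenomena.CardyFormulaZ2.Theorems.CardyIKTransportCornerLineDescentOfInfluenceBounds
import Summits.CriticalPhenomena.CardyFormulaZ2.Theorems.CardyIKTransportCornerLineDescentDiluteInfluenceReduction
import Summits.CriticalPhenomena.CardyFormulaZ2.Theorems.CardyIKTransportCornerLineDescentSummedInfluenceReduction
import Summits.CriticalPhenomena.CardyFormulaZ2.Theorems.CardyIKTransportCornerLineDescentDiluteInfluenceQuadrants
import Summits.CriticalPhenomena.CardyFormulaZ2.Theorems.CardyIKTransportCornerLineDescentOfCornerIrrelevance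
import Summits.CriticalPhenomena.CardyFormulaZ2.Theorems.CardyIKTransportCornerLineDescentOfTameStubs

/-!
# Line `symmetric-seed-second-order` — crux `CardyIKTransport.CornerLineDescent` (stmt-CriticalPhenomena-10964)
# CHECKED SKELETON — lead c4 RESHAPE (2026-08-16): TAME RECTANGLES + the crude-Cardy domain approximation

History (leads 0, c1, c2, c3; see the tree file `Cruxes/CornerLineDescent/Lines/symmetric_seed_second_order.lean`
@ commit of 2026-08-16T20:32Z for the full record): the line's Russo architecture is LANDED — `stub_Locality` p80521,
`stub_Russo` p82972, `stub_SyndromeBias` p89215, the eleven `Freeze*` files, the Schramm–Smirnov Lemma 5.1 chart chain and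
its discharge p99052, `stub_FreezeToStandard` p100600 (unconditional), the per-face reductions p87904 / p90774, the
composition `cornerLineDescent_of_registeredStubs` p106570, the stmt-5914 bridge p107327 and the rate-free factorisation
`…OfCornerIrrelevance` p125041 (crux ⟺ rate-free corner irrelevance ∀ R, under `CardyIK`).  What remained registered were
the two physics-open signed-influence estimates `stub_SummedInfluence` / `stub_DiluteInfluence`, quantified over ALL
conformal rectangles.

LEAD c4 RESHAPE (this file).  Lead c3's audit: over WILD conformal rectangles (free arcs of Minkowski dimension 2,
positive-area Jordan arcs — admissible `MarkedDomain 4`s) the POWER-RATE conclusions of both influence stubs are not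
credible (the boundary layer is not `O(δ⁻¹)` faces, its three-arm budget need not vanish with a rate), i.e. the two
stubs were plausibly MIS-STATED in their domain of quantification, while rate-free corner irrelevance stays plausible
for every `R`.  The repair keeps the composition idea and changes only WHERE the physics is asked for:

* the two influence stubs are now quantified over TAME rectangles only — `R.carrier = G(𝔻)` for a map `G` univalent
  (holomorphic and injective) on a LARGER disc `|z| < r`, `r > 1` (analytic boundary; finite length, `O(δ⁻¹)` boundary
  faces, regular marked points): `stub_SummedInfluenceTame`, `stub_DiluteInfluenceTame` (physics-open as before,
  handed back as crux-sized; every audit they survived applies verbatim);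
* and the line pays for the restriction with a PROVABLE pure bond-`ℤ²` theorem, Cardy's formula for crude crossing
  events passes from tame rectangles to all conformal rectangles (`crudeBondCardy_of_tame` below, sorry-free glue over
  four registered stubs):
  - `stub_DomainPerturbation` (lead): crude bond-`ℤ²` crossing probabilities of `R` and of its image `R.map T` under a
    plane homeomorphism `T` that is uniformly `η`-close to the identity on the unit neighbourhood of `closure R` differ
    by at most `ε`, for all small meshes — Schramm–Smirnov 2011 (5.1) (`Quad.continuity_of_lemma_5_1` ∘
    `SchrammSmirnov2011_lemma_5_1_holds`, p99052) at the chart quad of a square model of `R`, openness of the strict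
    order, and the landed sandwiches `Freeze.upperCrossing_subset_fatQuad_crossing` /
    `Freeze.thinQuad_crossing_subset_lowerCrossing` (p95222/p95383) applied to BOTH `R` (model `Φ`) and `R.map T`
    (model `Φ.trans T`);
  - `stub_RiemannMapPlaneExtension`: a Riemann map `𝔻 → D` of a Jordan domain extends to a homeomorphism of the
    plane (Carathéodory `JordanDomain.exists_continuousOn_extension_holds` + Schoenflies
    `Quad.exists_homeomorph_extend` through a square model of the disc);
  - `stub_TameShrink`: with `F` such an extension of `φ ∘ cayley⁻¹`, the conjugated shrink `T_λ = F ∘ (λ·) ∘ F⁻¹`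
    is `η`-close to the identity near `closure R` for `λ` close to `1`, `R.map T_λ` is tame (`G = F(λ ·)`,
    `r = 1/λ`), and `(T_λ ∘ φ, x)` uniformizes `R.map T_λ` with the SAME real preimages `x`
    (`MarkedDomain.IsUniformizing.image_data`) — so the modulus is untouched;
  - `stub_CornerIrrelevanceAt`: the per-rectangle form of the landed Russo plumbing (`uci_of`, `regimeOne_of`,
    `endgame_core` of p106570, whose proofs only ever use their hypotheses at the one rectangle `R`).
  The composition: `CardyIK` (all `R`) + the two tame stubs + `stub_CornerIrrelevanceAt` ⇒ Cardy for the frozen gauge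
  at every tame `R` ⇒ (frozen-end comparison `freezeComparisonAt`, unconditional, and tameness is similarity-invariant,
  `isTame_map_mulLeft₀`) Cardy for crude standard bond-`ℤ²` at every tame `R` ⇒ (`crudeBondCardy_of_tame`) at every
  `R`, which is the crux's consequent.  Six registered stubs (≤ stubs_max 7); the only `sorry`s of this file.

LEAD c4, END OF WAVE 1 (2026-08-16T21:3xZ): ALL FOUR PROVABLE STUBS OF THE TAME REDUCTION HAVE LANDED —
`stub_RiemannMapPlaneExtension` (p126030, `…RiemannMapPlaneExtension.lean`), `stub_TameShrink` (p126288, `…TameShrink.lean`),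
`stub_CornerIrrelevanceAt` (p126377, `…CornerIrrelevanceAt.lean`), `stub_DomainPerturbation` (p126558, `…DomainPerturbation.lean`) —
and so has the composition `Theorems/CardyIKTransportCornerLineDescentOfTameStubs.lean` (`crudeBondCardy_of_tame`, UNCONDITIONAL:
crude bond-`ℤ²` Cardy on tame rectangles ⇒ on all conformal rectangles; `cornerLineDescent_of_tameStubs`: the crux by name from the two
tame influence stubs).  They are used below by their landed names; the registered stubs still open are EXACTLY the two tame physics
stubs, and the skeleton theorem is `cornerLineDescent_of_tameStubs stub_SummedInfluenceTame stub_DiluteInfluenceTame`.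

DISPROOF USED (`Cruxes/CornerLineDescent/Disproof.lean`, cdisprove cycle 1 final, re-read 2026-08-16T20:5xZ by lead
c4): §B — no `_false_without_` theorem (the crux's only hypothesis is `CardyIK`, used here at `gaugeZeroCardyAt_of_tame`);
§A — what the stubs deliver is the `o(1)` bridge `P_IK − P_0 → 0` (now at tame `R`), as §A says any proof must;
§C (`Negative/ModelBlindTransport`) — honoured: `crudeBondCardy_of_tame` is a statement about the explicit bond measure
and explicit domains, not a transport of limit families (its content is the SS11 (5.1) estimate); §D / §G(4) — unchanged
(product-measure Russo; boundary layer budgeted inside the summed stub, now over rectifiable boundaries where the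
`δ⁻¹`-count is true).  No `-- Targets` theorem addresses the tame stubs; negatives index: none related.
-/

noncomputable section

namespace Summit.CriticalPhenomena.CardyFormulaZ2.Cruxes.CornerLineDescent.SymmetricSeedSecondOrder

open scoped Topology
open Filter Set
open Literature.Probability.RandomPlanarGeometry
open Summit.CriticalPhenomena.CardyFormulaZ2.Theorems.CornerLineDescent.SymmetricSeed

/-! ## §1 Registered stubs still open (the only `sorry`s of the line) -/

/-- STUB 1 · `stub_SummedInfluenceTame` — THE LOAD-BEARING PHYSICS STUB, now over TAME rectangles (lead c4 reshape of
`stub_SummedInfluence`; same conclusion `InfluenceBoundOn`, same landed reduction `stub_SummedInfluence_of_bulk_and_layer_bound`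
p90774): given the exponentially small conditional bias of the seed (`stub_SyndromeBias`, LANDED p89215), for every
conformal rectangle whose carrier is `G(𝔻)` with `G` univalent on a larger disc, the unsigned Russo sum of the corner seed
is second order in units of `ξ_p`: `Σ_f |I_f(p)| ≤ C p⁻¹ (δ/p)^θ` for `c₀ δ ≤ p ≤ p_IK`, eventually in `δ`.  Physics-open
(second-order arm-response theory + RSW for the non-FKG family `M_p`); over tame `R` the boundary layer IS `O(δ⁻¹)` faces
with the three-arm half-plane budget (Disproof §G(4), numerics j013862), which is what made the all-`R` form incredible
(lead c3 audit).  Held by the lead; handed back as crux-sized. [folklore] -/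
theorem stub_SummedInfluenceTame :
    (∀ p : ℝ, 0 < p → p < 1 → ∃ C : ℝ, SyndromeBiasAt p C) →
      ∀ R : ConformalRectangle,
        (∃ G : ℂ → ℂ, ∃ r : ℝ, 1 < r ∧ DifferentiableOn ℂ G (Metric.ball 0 r) ∧ Set.InjOn G (Metric.ball 0 r) ∧
          R.carrier = G '' Metric.ball 0 1) →
        ∃ θ C c₀ : ℝ, 0 < θ ∧ 0 < c₀ ∧ ∀ᶠ δ in 𝓝[>] (0:ℝ), InfluenceBoundOn R θ C c₀ δ := by
  sorry

/-- STUB 2 · `stub_DiluteInfluenceTame` — the frozen end's signed single-dislocation lemma (`x₀ > 1`), now over TAME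
rectangles (lead c4 reshape of `stub_DiluteInfluence`; same conclusion `DiluteBoundOn`, same landed reduction
`stub_DiluteInfluence_of_bulk_and_layer_bound` p87904, zero lemmas p85710, quadrant classification p102020): in the dilute
window `p ≤ c δ` the unsigned Russo sum is `≤ C δ^{κ−1}`.  Physics-open; handed back as crux-sized. [folklore] -/
theorem stub_DiluteInfluenceTame :
    ∀ R : ConformalRectangle,
      (∃ G : ℂ → ℂ, ∃ r : ℝ, 1 < r ∧ DifferentiableOn ℂ G (Metric.ball 0 r) ∧ Set.InjOn G (Metric.ball 0 r) ∧
        R.carrier = G '' Metric.ball 0 1) →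
      ∀ c : ℝ, 0 < c → ∃ C κ : ℝ, 0 < κ ∧ ∀ᶠ δ in 𝓝[>] (0:ℝ), DiluteBoundOn R c C κ δ := by
  sorry

/-! ## §2 Landed stubs of the tame reduction (lead c4, wave 1): used by name from the tree
`stub_DomainPerturbation` (p126558), `stub_RiemannMapPlaneExtension` (p126030), `stub_TameShrink` (p126288),
`stub_CornerIrrelevanceAt` (p126377); composition `crudeBondCardy_of_tame`, `tame_map_mulLeft₀`, `gaugeZeroCardyAt_of_tameStubs`,
`bondStdCardyAt_of_tameStubs`, `cornerLineDescent_of_tameStubs` (`…OfTameStubs.lean`). -/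

/-- SANITY: the unconditional tame reduction is in the tree (crude bond-`ℤ²` Cardy on tame rectangles ⇒ on all). [folklore] -/
example (hT : ∀ R : ConformalRectangle,
      (∃ G : ℂ → ℂ, ∃ r : ℝ, 1 < r ∧ DifferentiableOn ℂ G (Metric.ball 0 r) ∧ Set.InjOn G (Metric.ball 0 r) ∧
        R.carrier = G '' Metric.ball 0 1) →
      R.HasCrossingLimit (bondStdCrossingProb R) cardyFunction) :
    ∀ R : ConformalRectangle, R.HasCrossingLimit (bondStdCrossingProb R) cardyFunction :=
  crudeBondCardy_of_tame hT

/-! ## §3 The skeleton theorem -/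

/-- THE SKELETON THEOREM (D-0027 §3.3 / A12): concludes the crux `CornerLineDescent` BY NAME, modulo exactly the TWO
registered stubs still open (`stub_SummedInfluenceTame`, `stub_DiluteInfluenceTame` — the tame physics pair), through the
LANDED composition `cornerLineDescent_of_tameStubs` (lead c4): Cardy for `P_IK` ⇒ Cardy for crude standard bond-`ℤ²` at
every tame rectangle ⇒ (`crudeBondCardy_of_tame`, unconditional) at every conformal rectangle. [folklore] -/
theorem CornerLineDescent_of :
    Summit.CriticalPhenomena.CardyFormulaZ2.Theses.CardyIKTransport.CornerLineDescent :=
  cornerLineDescent_of_tameStubs stub_SummedInfluenceTame stub_DiluteInfluenceTame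

end Summit.CriticalPhenomena.CardyFormulaZ2.Cruxes.CornerLineDescent.SymmetricSeedSecondOrder
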